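import Summits.QuantumFields.YangMills.Theses.FradkinShenkerFlow
import Literature.MathematicalPhysics.QuantumFieldTheory.LatticeGaugeProofs

/-!
# Stub `stub_plantedTerminal` of the line `planted-link-pinning` (crux `SusceptibilityToPoincare`)

Route `FradkinShenkerFlow` of `YangMills`, crux item `stmt-QuantumFields-9441`
(`Summit.QuantumFields.YangMills.Theses.FradkinShenkerFlow.SusceptibilityToPoincare`, FS ⇒ UP).
This file proves stub S3f `stub_plantedTerminal` of the lead's registered skeleton of the line
`planted-link-pinning`: the ASSEMBLY of the planted terminal Poincaré inequality

  `Σ_Λ ε^{#Λᶜ} (1 − ε)^{#Λ} ∫ Var(F | U_Λ) dμ ≤ C · Σ_ℓ hb_ℓ(F)`     (`0 < ε ≤ ε₀`, all volumes)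

for the 4D torus Wilson measures `μ = wilsonMeasure r.ρ β` from its three ingredients, all taken as
hypotheses (they are the neighbouring stubs S3c, S3d, S3e of the skeleton):

* (S3c) link-set Poincaré: the residual variance given the links off a finite link set `D` is at most
  `A · B^{#D} · Σ_{ℓ ∈ D} hb_ℓ(F)`;
* (S3d) pinned cluster bound: for fixed pins `Λ` and a labelling `c` of the free links that is constant
  on free links sharing a plaquette, `E(F − E[F | U_Λ])² ≤ Σ_{ℓ ∉ Λ} A · B^{#block_Λ(ℓ)} · hb_ℓ(F)`;
* (S3e) free cluster tail: a plaquette-closed labelling whose planted block-size exponential moment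
  `Σ_{Λ ∌ ℓ} ε^{#Λᶜ} (1 − ε)^{#Λ} B^{#block_Λ(ℓ)}` is bounded by `C_T` uniformly in the volume and in `ℓ`.

## Proof

For each pin set `Λ`, the σ-algebra `⨆_{ℓ ∈ Λ} σ(U_ℓ)` is Mathlib's `cylinderEvents ↑Λ`
(definitionally), and `∫ condVar dμ = ∫ (F − μ[F | ·])² dμ` (`integral_condExp`); S3d (fed with S3c
and the labelling of S3e) bounds this by `Σ_{ℓ ∉ Λ} A B^{#block_Λ(ℓ)} hb_ℓ`. Multiplying by the
non-negative Bernoulli weight, summing over `Λ` and exchanging the two finite sums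
(`Finset.sum_comm`) gives `Σ_ℓ A hb_ℓ · (Σ_{Λ ∌ ℓ} w_Λ B^{#block_Λ(ℓ)}) ≤ (A C_T) Σ_ℓ hb_ℓ` by S3e and
`hb_ℓ ≥ 0`. Every compact `G`, every real `β`; the constant is `A · C_T`.
-/

noncomputable section

open MeasureTheory ProbabilityTheory
open Literature.MathematicalPhysics.QuantumFieldTheory

namespace Summit.QuantumFields.YangMills.Theorems.SusceptibilityToPoincare

namespace PlantedTerminal

/-- The σ-algebra generated by finitely many coordinates of a product, written as a finite supremum
of pulled-back coordinate σ-algebras, is Mathlib's `cylinderEvents` of the coerced finset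
(definitionally). [folklore] -/
theorem iSup_comap_eval_eq_cylinderEvents {ι X : Type*} [MeasurableSpace X] (Λ : Finset ι) :
    (⨆ ℓ ∈ Λ, MeasurableSpace.comap (fun V : ι → X => V ℓ) inferInstance) =
      cylinderEvents (X := fun _ : ι => X) (↑Λ : Set ι) := rfl

/-- For a finite measure on a product, the integral of the conditional variance given finitely
many coordinates is the mean square of the residual `F − μ[F | cylinderEvents Λ]`
(tower property `∫ μ[g | m] dμ = ∫ g dμ`). [folklore] -/
theorem integral_condVar_iSup_eq {ι X : Type*} [MeasurableSpace X] (Λ : Finset ι)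
    (μ : Measure (ι → X)) [IsFiniteMeasure μ] (F : (ι → X) → ℝ) :
    ∫ U, condVar (⨆ ℓ ∈ Λ, MeasurableSpace.comap (fun V : ι → X => V ℓ) inferInstance) F μ U ∂μ =
      ∫ U, (F U - (μ[F | cylinderEvents (↑Λ : Set ι)]) U) ^ 2 ∂μ := by
  rw [iSup_comap_eval_eq_cylinderEvents, condVar]
  exact integral_condExp cylinderEvents_le_pi

/-- Real arithmetic of the assembly: if `V Λ ≤ Σ_{ℓ ∉ Λ} A B^{N Λ ℓ} hb ℓ` for every pin set `Λ`,
the weights `w` and the terms `hb` are non-negative, `0 ≤ A`, and the planted moments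
`Σ_{Λ ∌ ℓ} w Λ B^{N Λ ℓ}` are at most `C_T` for every `ℓ`, then
`Σ_Λ w Λ V Λ ≤ (A C_T) Σ_ℓ hb ℓ` (exchange of the two finite sums). [folklore] -/
theorem weighted_sum_le {E : Type*} [Fintype E] [DecidableEq E] {A B CT : ℝ}
    (w V : Finset E → ℝ) (hb : E → ℝ) (N : Finset E → E → ℕ)
    (hA : 0 ≤ A) (hw : ∀ Λ, 0 ≤ w Λ) (hhb : ∀ ℓ, 0 ≤ hb ℓ)
    (hV : ∀ Λ, V Λ ≤ ∑ ℓ ∈ Finset.univ.filter (fun ℓ : E => ℓ ∉ Λ), A * B ^ N Λ ℓ * hb ℓ)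
    (htail : ∀ ℓ : E, ∑ Λ ∈ (Finset.univ : Finset (Finset E)).filter (fun Λ => ℓ ∉ Λ),
      w Λ * B ^ N Λ ℓ ≤ CT) :
    ∑ Λ, w Λ * V Λ ≤ A * CT * ∑ ℓ, hb ℓ := by
  calc ∑ Λ, w Λ * V Λ
      ≤ ∑ Λ, w Λ * ∑ ℓ ∈ Finset.univ.filter (fun ℓ : E => ℓ ∉ Λ), A * B ^ N Λ ℓ * hb ℓ :=
        Finset.sum_le_sum fun Λ _ => mul_le_mul_of_nonneg_left (hV Λ) (hw Λ)
    _ = ∑ Λ, ∑ ℓ, if ℓ ∉ Λ then w Λ * (A * B ^ N Λ ℓ * hb ℓ) else 0 := by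
        refine Finset.sum_congr rfl fun Λ _ => ?_
        rw [Finset.mul_sum, Finset.sum_filter]
    _ = ∑ ℓ, ∑ Λ, if ℓ ∉ Λ then w Λ * (A * B ^ N Λ ℓ * hb ℓ) else 0 := Finset.sum_comm
    _ = ∑ ℓ, A * hb ℓ * ∑ Λ ∈ (Finset.univ : Finset (Finset E)).filter (fun Λ => ℓ ∉ Λ),
          w Λ * B ^ N Λ ℓ := by
        refine Finset.sum_congr rfl fun ℓ _ => ?_
        rw [Finset.sum_filter, Finset.mul_sum]
        refine Finset.sum_congr rfl fun Λ _ => ?_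
        split_ifs <;> ring
    _ ≤ ∑ ℓ, A * hb ℓ * CT :=
        Finset.sum_le_sum fun ℓ _ => mul_le_mul_of_nonneg_left (htail ℓ) (mul_nonneg hA (hhb ℓ))
    _ = A * CT * ∑ ℓ, hb ℓ := by
        rw [Finset.mul_sum]
        exact Finset.sum_congr rfl fun ℓ _ => by ring

end PlantedTerminal

/-- **Stub S3f `stub_plantedTerminal`** of the line `planted-link-pinning` (crux
`SusceptibilityToPoincare`, FS ⇒ UP): the planted terminal Poincaré inequality
`Σ_Λ ε^{#Λᶜ}(1 − ε)^{#Λ} ∫ Var(F | U_Λ) dμ ≤ C Σ_ℓ hb_ℓ(F)` for the 4D torus Wilson measures, for all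
`0 < ε ≤ ε₀` with `C` independent of the volume, ASSEMBLED from the link-set Poincaré inequality
(S3c), the pinned cluster bound (S3d) and the free cluster tail (S3e), all three taken as
hypotheses: `⨆_{ℓ ∈ Λ} σ(U_ℓ) = cylinderEvents Λ`, `∫ condVar = E(F − E[F | ·])²`, and the exchange
of the two finite sums; the constant is `A · C_T(ε)` with `ε₀ = ε₀(B)` from S3e. [folklore] -/
theorem stub_plantedTerminal :
    ∀ (G : Type) [Group G] [TopologicalSpace G] [IsTopologicalGroup G] [CompactSpace G]
      [MeasurableSpace G] [BorelSpace G] (r : LatticeRep G) (β : ℝ),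
      (∃ A B : ℝ, 0 ≤ A ∧ 1 ≤ B ∧
        ∀ (S : ℕ) (μW : Measure (GaugeConfig 4 (2 * S + 1) G)),
        μW = (wilsonMeasure r.ρ β : Measure (GaugeConfig 4 (2 * S + 1) G)) →
        ∀ (D : Finset (Edge 4 (2 * S + 1))) (F : GaugeConfig 4 (2 * S + 1) G → ℝ),
        Measurable F → (∃ M : ℝ, ∀ U, |F U| ≤ M) →
        ∫ U, (F U - (μW[F | cylinderEvents ((↑D : Set (Edge 4 (2 * S + 1)))ᶜ)]) U) ^ 2 ∂μW ≤
          A * B ^ D.card * ∑ ℓ ∈ D, ∫ U, ∫ g, (F U - F (Function.update U ℓ g)) ^ 2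
            ∂((haarProbability G).tilted (fun g' => -β * wilsonAction r.ρ (Function.update U ℓ g'))) ∂μW) →
      (∀ (A B : ℝ), 0 ≤ A → 1 ≤ B →
        (∀ (S : ℕ) (μW : Measure (GaugeConfig 4 (2 * S + 1) G)),
          μW = (wilsonMeasure r.ρ β : Measure (GaugeConfig 4 (2 * S + 1) G)) →
          ∀ (D : Finset (Edge 4 (2 * S + 1))) (F : GaugeConfig 4 (2 * S + 1) G → ℝ),
          Measurable F → (∃ M : ℝ, ∀ U, |F U| ≤ M) →
          ∫ U, (F U - (μW[F | cylinderEvents ((↑D : Set (Edge 4 (2 * S + 1)))ᶜ)]) U) ^ 2 ∂μW ≤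
            A * B ^ D.card * ∑ ℓ ∈ D, ∫ U, ∫ g, (F U - F (Function.update U ℓ g)) ^ 2
              ∂((haarProbability G).tilted (fun g' => -β * wilsonAction r.ρ (Function.update U ℓ g'))) ∂μW) →
        ∀ (S : ℕ) (μW : Measure (GaugeConfig 4 (2 * S + 1) G)),
        μW = (wilsonMeasure r.ρ β : Measure (GaugeConfig 4 (2 * S + 1) G)) →
        ∀ (Λ : Finset (Edge 4 (2 * S + 1))) (c : Edge 4 (2 * S + 1) → ℕ),
        (∀ (y : Site 4 (2 * S + 1)) (i j : Fin 4), i < j →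
          ∀ e ∈ ({(y, i), (y.shift i, j), (y.shift j, i), (y, j)} : Finset (Edge 4 (2 * S + 1))),
          ∀ e' ∈ ({(y, i), (y.shift i, j), (y.shift j, i), (y, j)} : Finset (Edge 4 (2 * S + 1))),
          e ∉ Λ → e' ∉ Λ → c e = c e') →
        ∀ (F : GaugeConfig 4 (2 * S + 1) G → ℝ), Measurable F → (∃ M : ℝ, ∀ U, |F U| ≤ M) →
        ∫ U, (F U - (μW[F | cylinderEvents (↑Λ : Set (Edge 4 (2 * S + 1)))]) U) ^ 2 ∂μW ≤
          ∑ ℓ ∈ Finset.univ.filter (fun ℓ : Edge 4 (2 * S + 1) => ℓ ∉ Λ),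
            A * B ^ (Finset.univ.filter (fun ℓ' : Edge 4 (2 * S + 1) => ℓ' ∉ Λ ∧ c ℓ' = c ℓ)).card *
              ∫ U, ∫ g, (F U - F (Function.update U ℓ g)) ^ 2
                ∂((haarProbability G).tilted (fun g' => -β * wilsonAction r.ρ (Function.update U ℓ g'))) ∂μW) →
      (∀ (B : ℝ), 1 ≤ B → ∃ ε₀ : ℝ, 0 < ε₀ ∧ ε₀ < 1 ∧ ∀ ε : ℝ, 0 < ε → ε ≤ ε₀ → ∃ C : ℝ, 0 ≤ C ∧
        ∀ (S : ℕ), ∃ c : Finset (Edge 4 (2 * S + 1)) → Edge 4 (2 * S + 1) → ℕ,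
          (∀ (Λ : Finset (Edge 4 (2 * S + 1))) (y : Site 4 (2 * S + 1)) (i j : Fin 4), i < j →
            ∀ e ∈ ({(y, i), (y.shift i, j), (y.shift j, i), (y, j)} : Finset (Edge 4 (2 * S + 1))),
            ∀ e' ∈ ({(y, i), (y.shift i, j), (y.shift j, i), (y, j)} : Finset (Edge 4 (2 * S + 1))),
            e ∉ Λ → e' ∉ Λ → c Λ e = c Λ e') ∧
          ∀ ℓ : Edge 4 (2 * S + 1),
            ∑ Λ ∈ (Finset.univ : Finset (Finset (Edge 4 (2 * S + 1)))).filter (fun Λ => ℓ ∉ Λ),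
              ε ^ (Fintype.card (Edge 4 (2 * S + 1)) - Λ.card) * (1 - ε) ^ Λ.card *
                B ^ (Finset.univ.filter (fun ℓ' : Edge 4 (2 * S + 1) => ℓ' ∉ Λ ∧ c Λ ℓ' = c Λ ℓ)).card ≤ C) →
      ∃ ε₀ : ℝ, 0 < ε₀ ∧ ε₀ < 1 ∧ ∀ ε : ℝ, 0 < ε → ε ≤ ε₀ → ∃ C : ℝ, 0 ≤ C ∧
        ∀ (S : ℕ) (μW : Measure (GaugeConfig 4 (2 * S + 1) G)),
        μW = (wilsonMeasure r.ρ β : Measure (GaugeConfig 4 (2 * S + 1) G)) →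
        ∀ (F : GaugeConfig 4 (2 * S + 1) G → ℝ), Measurable F → (∃ M : ℝ, ∀ U, |F U| ≤ M) →
        (∑ Λ : Finset (Edge 4 (2 * S + 1)),
          ε ^ (Fintype.card (Edge 4 (2 * S + 1)) - Λ.card) * (1 - ε) ^ Λ.card *
            ∫ U, condVar (⨆ ℓ ∈ Λ, MeasurableSpace.comap (fun V : GaugeConfig 4 (2 * S + 1) G => V ℓ) inferInstance)
              F μW U ∂μW) ≤
          C * ∑ ℓ : Edge 4 (2 * S + 1), ∫ U, ∫ g, (F U - F (Function.update U ℓ g)) ^ 2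
            ∂((haarProbability G).tilted (fun g' => -β * wilsonAction r.ρ (Function.update U ℓ g'))) ∂μW := by
  intro G _ _ _ _ _ _ r β h3c h3d h3e
  obtain ⟨A, B, hA, hB, hc⟩ := h3c
  obtain ⟨ε₀, hε₀, hε₀1, hT⟩ := h3e B hB
  refine ⟨ε₀, hε₀, hε₀1, fun ε hε hεε₀ => ?_⟩
  obtain ⟨CT, hCT0, hCT⟩ := hT ε hε hεε₀
  refine ⟨A * CT, mul_nonneg hA hCT0, fun S μW hμ F hF hM => ?_⟩
  obtain ⟨c, hclosed, htail⟩ := hCT S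
  haveI : IsProbabilityMeasure μW := by
    rw [hμ]
    exact isProbabilityMeasure_wilsonMeasure (d := 4) (L := 2 * S + 1) r.ρ r.continuous β
  refine PlantedTerminal.weighted_sum_le
    (fun Λ : Finset (Edge 4 (2 * S + 1)) =>
      ε ^ (Fintype.card (Edge 4 (2 * S + 1)) - Λ.card) * (1 - ε) ^ Λ.card)
    (fun Λ : Finset (Edge 4 (2 * S + 1)) =>
      ∫ U, condVar (⨆ ℓ ∈ Λ, MeasurableSpace.comap
        (fun V : GaugeConfig 4 (2 * S + 1) G => V ℓ) inferInstance) F μW U ∂μW)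
    (fun ℓ : Edge 4 (2 * S + 1) => ∫ U, ∫ g, (F U - F (Function.update U ℓ g)) ^ 2
      ∂((haarProbability G).tilted (fun g' => -β * wilsonAction r.ρ (Function.update U ℓ g'))) ∂μW)
    (fun (Λ : Finset (Edge 4 (2 * S + 1))) (ℓ : Edge 4 (2 * S + 1)) =>
      (Finset.univ.filter (fun ℓ' : Edge 4 (2 * S + 1) => ℓ' ∉ Λ ∧ c Λ ℓ' = c Λ ℓ)).card)
    hA (fun Λ => mul_nonneg (pow_nonneg hε.le _)
      (pow_nonneg (sub_nonneg.2 (hεε₀.trans hε₀1.le)) _))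
    (fun ℓ => integral_nonneg fun U => integral_nonneg fun g => sq_nonneg _)
    (fun Λ => ?_) htail
  exact (PlantedTerminal.integral_condVar_iSup_eq Λ μW F).le.trans
    (h3d A B hA hB hc S μW hμ Λ (c Λ) (hclosed Λ) F hF hM)

end Summit.QuantumFields.YangMills.Theorems.SusceptibilityToPoincare
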